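import Literature.Barriers.NavierStokesRegularity.DiffeomorphismNonInvarianceFamily
import Mathlib.Analysis.SpecialFunctions.SmoothTransition
import HarnessLib

/-!
# Barrier family, part 2: time-dependent gauges — even a gauge family starting at the identity
# (`ψ₀ = id`, smoothly switched on) conjugates a global smooth solution to a non-solution; the
# push-forward / pull-back transfer laws are false for every viscosity
# (Fushchich–Shtelen–Slavutsky 1991 §1 (1.2)–(1.3); Acheson 1990 §2.3 (2.9))

Second family file of the barrier entry `DiffeomorphismNonInvariance` (catalogue `NavierStokesRegularity`,
D-0021; D-0090 NS-CLAIMS cell, salvage seat `ns-claims-salvage-p6`, METHOD LEVEL, everything PROVED),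
namespace `…NavierStokesRegularity.DiffeoGauge`. Part 1 (`DiffeomorphismNonInvarianceFamily`) has the
static witness; here the gauge is made TIME-DEPENDENT in exactly the shape the C170 text uses for its
first gauge ((19) p. 15: `ψ_t = λ(t)`-interpolation from the identity to a fixed map, frozen for
`t ≥ 1`) and in exactly the class of its Definition 2.6 / the skeleton's `GaugeFamily` (jointly smooth on
`[0, ∞) × ℝ³`, smooth two-sided inverses, `ψ₀ = id`):

* `gauge t x = x + λ(t)(x₁³/6) e₀`, `λ = Real.smoothTransition` (`λ(0) = 0`, `λ ≡ 1` on `[1, ∞)`),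
  `gaugeInv t y = y − λ(t)(y₁³/6) e₀`: `gauge_zero` (`ψ₀ = id`), inverses, joint smoothness on all of
  `ℝ × ℝ³`, and `pushforward_gauge_stream`: for `t ≥ 1` the conjugate of the uniform stream `c e₁` is
  the bent stream `v_c` of part 1;
* `not_isClassicalNSSolutionOn_gauge_stream`: for `c ≠ 0` and every real `ν`, the conjugated velocity
  `t ↦ (ψ_t)_*(c e₁)` is not a classical solution on `[0, ∞)` for ANY pressure (it equals `v_c` near
  `t = 2`, where part 1's obstruction applies);
* the laws `PushforwardLaw ν S` / `PullbackLaw ν S` (all jointly smooth gauge families with smooth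
  inverses) and `IdGaugeLaw ν` (the `GaugeFamily` class VERBATIM: joint smoothness on `Ici 0`, inverses
  for `t ≥ 0`, `ψ₀ = id`; the reference field itself a global classical solution) with their refutations
  `not_pushforwardLaw`, `not_pullbackLaw`, `not_idGaugeLaw` for every `ν`.

WHAT THIS IS NOT: not a claim about NS regularity or blow-up; not a claim about any author beyond the
typed locator.
-/

noncomputable section

open Set Function InnerProductSpace Filter
open scoped ContDiff Laplacian RealInnerProductSpace Topology

namespace Literature.Barriers.NavierStokesRegularity.DiffeoGauge

open Literature.Analysis.FluidPDE Literature.Analysis.FluidPDE.ParallelShear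

/-! ### The transfer laws over ALL smooth gauge families (static witness of part 1) -/

/-- **THE PUSH-FORWARD TRANSFER LAW** (time-dependent gauge form, the grain of display (6) p. 11 of the
C170 text «`V(t) = (ψ_t)_* V_ax(t)` satisfies the Navier–Stokes equations iff …»): for every jointly
smooth family of smooth coordinate changes `ψ_t` of `ℝ³` with jointly smooth two-sided inverses
`ψ_t⁻¹`, and every unforced classical solution `(W, r)` on the time set `S`, the conjugated velocity
`t ↦ (ψ_t)_* W(t)` is again an unforced classical solution on `S` for SOME pressure. The maximal Lie
point symmetry algebra of the system contains no `x`-dependent deformation beyond rotations and the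
scaling, so the law asserts a symmetry the classification excludes.
[cite: FushchichShtelenSlavutsky1991, §1 eqs. (1.2)–(1.3) p. 971] -/
def PushforwardLaw (ν : ℝ) (S : Set ℝ) : Prop :=
  ∀ (ψ ψinv : ℝ → E3 → E3), ContDiff ℝ ∞ (uncurry ψ) → ContDiff ℝ ∞ (uncurry ψinv) →
    (∀ t, LeftInverse (ψinv t) (ψ t)) → (∀ t, RightInverse (ψinv t) (ψ t)) →
    ∀ (W : ℝ → E3 → E3) (r : ℝ → E3 → ℝ), IsClassicalNSSolutionOn S ν 0 W r →
      ∃ q : ℝ → E3 → ℝ, IsClassicalNSSolutionOn S ν 0 (fun t => pushforward (ψ t) (ψinv t) (W t)) q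

/-- **THE PULL-BACK TRANSFER LAW** (the grain of §5.6 p. 23 of the C170 text, where the reference
field is DEFINED as the pull-back `V_ax(t) := ψ_t^* V(t)` of the Navier–Stokes solution): for every
such gauge family and every classical solution `(V, p)`, the pulled-back velocity `t ↦ ψ_t^* V(t)`
is again a classical (Euclidean) Navier–Stokes solution for some pressure.
[cite: FushchichShtelenSlavutsky1991, §1 eqs. (1.2)–(1.3) p. 971] -/
def PullbackLaw (ν : ℝ) (S : Set ℝ) : Prop :=
  ∀ (ψ ψinv : ℝ → E3 → E3), ContDiff ℝ ∞ (uncurry ψ) → ContDiff ℝ ∞ (uncurry ψinv) →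
    (∀ t, LeftInverse (ψinv t) (ψ t)) → (∀ t, RightInverse (ψinv t) (ψ t)) →
    ∀ (V : ℝ → E3 → E3) (p : ℝ → E3 → ℝ), IsClassicalNSSolutionOn S ν 0 V p →
      ∃ q : ℝ → E3 → ℝ, IsClassicalNSSolutionOn S ν 0 (fun t => pullback (ψ t) (ψinv t) (V t)) q

/-- **The push-forward transfer law is false** for every viscosity `ν` (Euler `ν = 0` included) on
every nonempty time set of unique differentiability (`[0, ∞)`, `[0, T)`, all of `ℝ`, …): the constant
family «cubic shear gauge» conjugates the uniform stream `e₁` to the bent stream `v₁`, which admits no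
pressure. [cite: Acheson1990, §2.3 eq. (2.9)] -/
theorem not_pushforwardLaw (ν : ℝ) {S : Set ℝ} (hS : UniqueDiffOn ℝ S) (hne : S.Nonempty) :
    ¬ PushforwardLaw ν S := by
  intro hlaw
  obtain ⟨t, ht⟩ := hne
  have hψ : ContDiff ℝ ∞ (uncurry fun (_ : ℝ) (x : E3) => shearMap cubic x) :=
    (contDiff_shearMap contDiff_cubic').comp contDiff_snd
  have hψinv : ContDiff ℝ ∞ (uncurry fun (_ : ℝ) (y : E3) => shearMapInv cubic y) :=
    (contDiff_shearMapInv contDiff_cubic').comp contDiff_snd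
  obtain ⟨q, hq⟩ := hlaw (fun _ => shearMap cubic) (fun _ => shearMapInv cubic) hψ hψinv
    (fun _ => leftInverse_shearMap cubic) (fun _ => rightInverse_shearMap cubic)
    (fun (_ : ℝ) (_ : E3) => (1 : ℝ) • EuclideanSpace.single (1 : Fin 3) (1 : ℝ))
    (fun (_ : ℝ) (_ : E3) => (0 : ℝ)) (isClassicalNSSolutionOn_uniformStream hS ν 1)
  exact not_isClassicalNSSolutionOn_pushforward_stream ht one_ne_zero ν q hq

/-- **The pull-back transfer law is false** likewise (pull back by the INVERSE cubic shear gauge,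
which is the push-forward by the gauge itself). [cite: Acheson1990, §2.3 eq. (2.9)] -/
theorem not_pullbackLaw (ν : ℝ) {S : Set ℝ} (hS : UniqueDiffOn ℝ S) (hne : S.Nonempty) :
    ¬ PullbackLaw ν S := by
  intro hlaw
  obtain ⟨t, ht⟩ := hne
  have hψ : ContDiff ℝ ∞ (uncurry fun (_ : ℝ) (x : E3) => shearMap cubic x) :=
    (contDiff_shearMap contDiff_cubic').comp contDiff_snd
  have hψinv : ContDiff ℝ ∞ (uncurry fun (_ : ℝ) (y : E3) => shearMapInv cubic y) :=
    (contDiff_shearMapInv contDiff_cubic').comp contDiff_snd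
  obtain ⟨q, hq⟩ := hlaw (fun _ => shearMapInv cubic) (fun _ => shearMap cubic) hψinv hψ
    (fun _ => rightInverse_shearMap cubic) (fun _ => leftInverse_shearMap cubic)
    (fun (_ : ℝ) (_ : E3) => (1 : ℝ) • EuclideanSpace.single (1 : Fin 3) (1 : ℝ))
    (fun (_ : ℝ) (_ : E3) => (0 : ℝ)) (isClassicalNSSolutionOn_uniformStream hS ν 1)
  exact not_isClassicalNSSolutionOn_pushforward_stream ht one_ne_zero ν q hq

/-! ### A gauge family switched on from the identity (`ψ₀ = id`), the C170 shape (19) p. 15 -/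

/-- The switching profile `λ(t)·(s³/6)`, `λ = Real.smoothTransition`: `λ(t) = 0` for `t ≤ 0`,
`λ(t) = 1` for `t ≥ 1`, smooth. [folklore] -/
def switchedCubic (t : ℝ) (s : ℝ) : ℝ := Real.smoothTransition t * cubic s

/-- **The switched-on cubic shear gauge** `ψ_t(x) = x + λ(t)(x₁³/6) e₀`. [folklore] -/
def gauge (t : ℝ) : E3 → E3 := shearMap (switchedCubic t)

/-- Its inverse `ψ_t⁻¹(y) = y − λ(t)(y₁³/6) e₀`. [folklore] -/
def gaugeInv (t : ℝ) : E3 → E3 := shearMapInv (switchedCubic t)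

/-- `h(s) = s³/6` is smooth (re-export for this file). [folklore] -/
private theorem contDiff_cubic_loc : ContDiff ℝ ∞ cubic := contDiff_cubic'

/-- `(t, s) ↦ λ(t) s³/6` is jointly smooth. [folklore] -/
private theorem contDiff_switchedCubic_uncurry : ContDiff ℝ ∞ (uncurry switchedCubic) := by
  have h1 : ContDiff ℝ ∞ (fun q : ℝ × ℝ => Real.smoothTransition q.1) :=
    Real.smoothTransition.contDiff.comp contDiff_fst
  have h2 : ContDiff ℝ ∞ (fun q : ℝ × ℝ => cubic q.2) := contDiff_cubic_loc.comp contDiff_snd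
  have hfun : uncurry switchedCubic = fun q : ℝ × ℝ => Real.smoothTransition q.1 * cubic q.2 := by
    funext q; rfl
  rw [hfun]
  exact h1.mul h2

/-- Each slice `s ↦ λ(t) s³/6` is differentiable. [folklore] -/
private theorem differentiable_switchedCubic (t : ℝ) : Differentiable ℝ (switchedCubic t) :=
  (contDiff_cubic_loc.differentiable (by simp)).const_mul (Real.smoothTransition t)

/-- `ψ₀ = id` (the gauge starts at the identity, as Definition 2.6 / the skeleton's `GaugeFamily.init`
require). [cite: FushchichShtelenSlavutsky1991, §1 eqs. (1.2)–(1.3) p. 971] -/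
theorem gauge_zero (x : E3) : gauge 0 x = x := by
  simp [gauge, shearMap, switchedCubic, Real.smoothTransition.zero_of_nonpos le_rfl]

/-- For `t ≥ 1` the gauge is frozen at the cubic shear map of part 1.
[cite: FushchichShtelenSlavutsky1991, §1 eqs. (1.2)–(1.3) p. 971] -/
theorem gauge_of_one_le {t : ℝ} (ht : 1 ≤ t) : gauge t = shearMap cubic ∧ gaugeInv t = shearMapInv cubic := by
  have hl : switchedCubic t = cubic := by
    funext s; simp [switchedCubic, Real.smoothTransition.one_of_one_le ht]
  simp [gauge, gaugeInv, hl]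

/-- `ψ_t⁻¹ ∘ ψ_t = id` for every `t`. [cite: FushchichShtelenSlavutsky1991, §1 eqs. (1.2)–(1.3) p. 971] -/
theorem leftInverse_gauge (t : ℝ) : LeftInverse (gaugeInv t) (gauge t) :=
  leftInverse_shearMap _

/-- `ψ_t ∘ ψ_t⁻¹ = id` for every `t`. [cite: FushchichShtelenSlavutsky1991, §1 eqs. (1.2)–(1.3) p. 971] -/
theorem rightInverse_gauge (t : ℝ) : RightInverse (gaugeInv t) (gauge t) :=
  rightInverse_shearMap _

/-- The gauge family is jointly smooth on all of `ℝ × ℝ³` (so on `[0, ∞) × ℝ³`).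
[cite: FushchichShtelenSlavutsky1991, §1 eqs. (1.2)–(1.3) p. 971] -/
theorem contDiff_gauge_uncurry : ContDiff ℝ ∞ (uncurry gauge) := by
  have h1 : ContDiff ℝ ∞ (fun q : ℝ × E3 => switchedCubic q.1 (q.2 1)) :=
    contDiff_switchedCubic_uncurry.comp
      (contDiff_fst.prodMk ((EuclideanSpace.proj (1 : Fin 3) : E3 →L[ℝ] ℝ).contDiff.comp contDiff_snd))
  have h : ContDiff ℝ ∞ (fun q : ℝ × E3 =>
      q.2 + switchedCubic q.1 (q.2 1) • EuclideanSpace.single (0 : Fin 3) (1 : ℝ)) :=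
    contDiff_snd.add (h1.smul contDiff_const)
  have hfun : uncurry gauge = fun q : ℝ × E3 =>
      q.2 + switchedCubic q.1 (q.2 1) • EuclideanSpace.single (0 : Fin 3) (1 : ℝ) := by
    funext q; rfl
  rw [hfun]
  exact h

/-- The inverse family is jointly smooth. [cite: FushchichShtelenSlavutsky1991, §1 eqs. (1.2)–(1.3) p. 971] -/
theorem contDiff_gaugeInv_uncurry : ContDiff ℝ ∞ (uncurry gaugeInv) := by
  have h1 : ContDiff ℝ ∞ (fun q : ℝ × E3 => switchedCubic q.1 (q.2 1)) :=
    contDiff_switchedCubic_uncurry.comp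
      (contDiff_fst.prodMk ((EuclideanSpace.proj (1 : Fin 3) : E3 →L[ℝ] ℝ).contDiff.comp contDiff_snd))
  have h : ContDiff ℝ ∞ (fun q : ℝ × E3 =>
      q.2 - switchedCubic q.1 (q.2 1) • EuclideanSpace.single (0 : Fin 3) (1 : ℝ)) :=
    contDiff_snd.sub (h1.smul contDiff_const)
  have hfun : uncurry gaugeInv = fun q : ℝ × E3 =>
      q.2 - switchedCubic q.1 (q.2 1) • EuclideanSpace.single (0 : Fin 3) (1 : ℝ) := by
    funext q; rfl
  rw [hfun]
  exact h

/-- Joint smoothness in the tree's space-time sense on any time set. [cite: FushchichShtelenSlavutsky1991, §1 eqs. (1.2)–(1.3) p. 971] -/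
theorem isSmoothSpaceTimeOn_gauge (S : Set ℝ) :
    IsSmoothSpaceTimeOn S gauge ∧ IsSmoothSpaceTimeOn S gaugeInv :=
  ⟨contDiff_gauge_uncurry.contDiffOn, contDiff_gaugeInv_uncurry.contDiffOn⟩

/-- **The conjugate of the uniform stream under the switched gauge**: for `t ≥ 1` it is the bent
stream `v_c` of part 1. [cite: FushchichShtelenSlavutsky1991, §1 eqs. (1.2)–(1.3) p. 971] -/
theorem pushforward_gauge_stream {t : ℝ} (ht : 1 ≤ t) (c : ℝ) :
    pushforward (gauge t) (gaugeInv t) (fun _ : E3 => c • EuclideanSpace.single (1 : Fin 3) (1 : ℝ)) =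
      bentStream c := by
  rw [(gauge_of_one_le ht).1, (gauge_of_one_le ht).2, pushforward_shearMap_stream]

/-- **The switched gauge conjugates a global smooth solution to a non-solution**: for `c ≠ 0` and
every real `ν`, the velocity `t ↦ (ψ_t)_*(c e₁)` — which starts AS the solution `c e₁` at `t = 0` —
is not a classical Navier–Stokes / Euler solution on `[0, ∞)` for any pressure (near `t = 2` it is the
steady bent stream, whose forced pressure gradient is not a gradient).
[cite: Acheson1990, §2.3 eq. (2.9)] -/
theorem not_isClassicalNSSolutionOn_gauge_stream {c : ℝ} (hc : c ≠ 0) (ν : ℝ) (q : ℝ → E3 → ℝ) :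
    ¬ IsClassicalNSSolutionOn (Ici 0) ν 0
        (fun t => pushforward (gauge t) (gaugeInv t)
          (fun _ : E3 => c • EuclideanSpace.single (1 : Fin 3) (1 : ℝ))) q := by
  have hev : ∀ᶠ s in nhds (2 : ℝ),
      (fun t => pushforward (gauge t) (gaugeInv t)
        (fun _ : E3 => c • EuclideanSpace.single (1 : Fin 3) (1 : ℝ))) s = bentStream c := by
    have hmem : Ici (1 : ℝ) ∈ nhds (2 : ℝ) := Ici_mem_nhds (by norm_num)
    filter_upwards [hmem] with s hs
    exact pushforward_gauge_stream hs c
  exact not_isClassicalNSSolutionOn_of_eventuallyEq_bentStream (t := 2) (by norm_num) hc hev ν q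

/-- **THE GAUGE-CLASS TRANSFER LAW** — the class of Definition 2.6 p. 12 / the skeleton's
`GaugeFamily` VERBATIM (forward and inverse maps jointly `C^∞` on `[0, ∞) × ℝ³`, mutually inverse for
`t ≥ 0`, `ψ₀ = id`) with a reference field that is ITSELF a global classical solution: «then
`t ↦ (ψ_t)_* W(t)` is a global classical solution for some pressure».
[cite: FushchichShtelenSlavutsky1991, §1 eqs. (1.2)–(1.3) p. 971] -/
def IdGaugeLaw (ν : ℝ) : Prop :=
  ∀ (ψ ψi : ℝ → E3 → E3), IsSmoothSpaceTimeOn (Ici 0) ψ → IsSmoothSpaceTimeOn (Ici 0) ψi →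
    (∀ t, 0 ≤ t → ∀ x, ψi t (ψ t x) = x) → (∀ t, 0 ≤ t → ∀ y, ψ t (ψi t y) = y) → (∀ x, ψ 0 x = x) →
    ∀ (W : ℝ → E3 → E3) (r : ℝ → E3 → ℝ), IsClassicalNSSolutionOn (Ici 0) ν 0 W r →
      ∃ q : ℝ → E3 → ℝ, IsClassicalNSSolutionOn (Ici 0) ν 0 (fun t => pushforward (ψ t) (ψi t) (W t)) q

/-- **The gauge-class transfer law is false for every `ν`**: the switched cubic shear gauge is in the
class, the uniform stream `e₁` is a global classical solution, and their conjugate is not.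
[cite: Acheson1990, §2.3 eq. (2.9)] -/
theorem not_idGaugeLaw (ν : ℝ) : ¬ IdGaugeLaw ν := by
  intro hlaw
  obtain ⟨q, hq⟩ := hlaw gauge gaugeInv (isSmoothSpaceTimeOn_gauge _).1 (isSmoothSpaceTimeOn_gauge _).2
    (fun t _ x => leftInverse_gauge t x) (fun t _ y => rightInverse_gauge t y) gauge_zero
    (fun (_ : ℝ) (_ : E3) => (1 : ℝ) • EuclideanSpace.single (1 : Fin 3) (1 : ℝ))
    (fun (_ : ℝ) (_ : E3) => (0 : ℝ)) (isClassicalNSSolutionOn_uniformStream (uniqueDiffOn_Ici 0) ν 1)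
  exact not_isClassicalNSSolutionOn_gauge_stream one_ne_zero ν q hq

end Literature.Barriers.NavierStokesRegularity.DiffeoGauge

end
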